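import Mathlib
import Summits.Ventures.PercRepro2.SwOutMixedArmsBaseEdgeMap

/-!
# The several-arms base: the edge-set forms of the hull formulas (G2′) (blind cell PercRepro2,
night-4 g20, 2026-08-27; proofs/NIGHT4-G20.md §4′)

At a point without red-side leak the red edges of the red cluster of `h` are exactly the red
classes of the abstract red set (`redEdges_mixedRealR`), and at a point without blue-side leak the
blue edges of the blue cluster are the red classes of the abstract blue set
(`blueEdges_mixedRealR`, by duality: the dual base has the same red classes,
`redClassR_dualMixedR`).  These are the hypotheses `hR` / `hB` of the transfer
`card_le_of_mixedArms_edges`.  The single-arm twin is `SwOutMixedCoreEdges`.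
-/

namespace Summit.Ventures.PercRepro2

namespace MixedArms

open Hull LocRows

variable {V : Type*} {E : Type*}

open scoped Classical

section RedEdges

variable {ends : E → Sym2 V} {σ : Config E} {h u : V} {ι ρ ν κ : Type*} {U : ι → Set V}
  {p : ρ → V} {Ah : ν → Set V} {arm : ν → ρ} {F : κ → Set V}
  (hb : MixedBaseR ends σ h u U p Ah arm F)
include hb

/-- An edge inside `U j ∪ {h, u}` touches `U j`. -/
lemma MixedBaseR.touches_U_of_within' {j : ι} {e : E} (he : e ∈ within ends (U j ∪ {h, u})) :
    e ∈ touches ends (U j) := by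
  obtain ⟨x, hx, y, hy, hxy⟩ := he
  rcases hx with hx | hx
  · exact ⟨x, hx, y, hxy⟩
  rcases hy with hy | hy
  · exact ⟨y, hy, x, ends_swap hxy⟩
  exfalso
  simp only [Set.mem_insert_iff, Set.mem_singleton_iff] at hx hy
  rcases hx with rfl | rfl <;> rcases hy with rfl | rfl
  · exact hb.loop_h e hxy
  · exact hb.no_hu e hxy
  · exact hb.no_hu e (ends_swap hxy)
  · exact hb.loop_u e hxy

/-- A vertex of `U j ∪ {h, u}` is in the predicted red cluster when `U j` is red. -/
lemma MixedBaseR.mem_redSetR_of_mem_U_h_u {q : PtR ι ρ ν κ} {j : ι} (hj : q.1 j = true) {x : V}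
    (hx : x ∈ U j ∪ {h, u}) : x ∈ redSetR h u U p Ah F q := by
  rcases hx with hx | hx
  · exact (hb.mem_redSetR_U hx).2 hj
  · simp only [Set.mem_insert_iff, Set.mem_singleton_iff] at hx
    rcases hx with rfl | rfl
    · rw [mem_redSetR_iff]
      exact Or.inl rfl
    · exact hb.mem_redSetR_u.2 ⟨j, hj⟩

/-- A vertex of `Ah i ∪ {h}` is in the predicted red cluster when the piece is red. -/
lemma MixedBaseR.mem_redSetR_of_mem_Ah_h {q : PtR ι ρ ν κ} {i : ν} (hi : q.2.1 i = true) {x : V}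
    (hx : x ∈ Ah i ∪ {h}) : x ∈ redSetR h u U p Ah F q := by
  rcases hx with hx | hx
  · exact (hb.mem_redSetR_Ah hx).2 hi
  · rw [Set.mem_singleton_iff] at hx
    rw [hx, mem_redSetR_iff]
    exact Or.inl rfl

/-- A vertex of `F k ∪ {h}` is in the predicted red cluster when `F k` is red. -/
lemma MixedBaseR.mem_redSetR_of_mem_F_h {q : PtR ι ρ ν κ} {k : κ} (hk : q.2.2.2.2 k = true)
    {x : V} (hx : x ∈ F k ∪ {h}) : x ∈ redSetR h u U p Ah F q := by
  rcases hx with hx | hx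
  · exact (hb.mem_redSetR_F hx).2 hk
  · rw [Set.mem_singleton_iff] at hx
    rw [hx, mem_redSetR_iff]
    exact Or.inl rfl

/-- **The red edge-set form of the hull formula**: at a point without red-side leak, the red edges
of the red cluster of `h` are exactly the red classes of the abstract red set (assuming an edge
between `u` and every dropped vertex). -/
theorem MixedBaseR.redEdges_mixedRealR (hup : ∀ r, ∃ e, ends e = s(u, p r)) {q : PtR ι ρ ν κ}
    (hq : ¬ LeakRR arm q) :
    redEdges ends (mixedRealR ends u U p Ah F σ q) h = φR ends σ h u U p Ah F (ER q) := by
  ext e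
  rw [mem_redEdges, hb.cluster_mixedRealR hup hq, mem_φR]
  constructor
  · rintro ⟨hred, x, hx, y, hy, hxy⟩
    rw [mem_redSetR_iff] at hx
    rcases hx with rfl | ⟨j, hj, hx⟩ | ⟨rfl, hs⟩ | ⟨r, rfl, hs, huP⟩ | ⟨i, hi, hx⟩ | ⟨k, hk, hx⟩
    · -- `x = h`: the edge goes into an arm
      rcases hb.h_edges e y hxy with ⟨j, hy'⟩ | ⟨i, hy'⟩ | ⟨k, hy'⟩
      · have hj : q.1 j = true := (hb.mem_redSetR_U hy').1 hy
        refine ⟨Sum.inl j, hj, ?_⟩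
        rw [redClassR_inl]
        refine ⟨?_, x, Or.inr (Or.inl rfl), y, Or.inl hy', hxy⟩
        rwa [hb.mixedRealR_apply_U ⟨y, hy', x, ends_swap hxy⟩, if_pos hj] at hred
      · have hi : q.2.1 i = true := (hb.mem_redSetR_Ah hy').1 hy
        refine ⟨Sum.inr (Sum.inr (Sum.inl i)), hi, ?_⟩
        rw [redClassR_a]
        refine ⟨?_, x, Or.inr rfl, y, Or.inl hy', hxy⟩
        rwa [hb.mixedRealR_apply_Ah ⟨y, hy', x, ends_swap hxy⟩, if_pos hi] at hred
      · have hk : q.2.2.2.2 k = true := (hb.mem_redSetR_F hy').1 hy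
        refine ⟨Sum.inr (Sum.inr (Sum.inr (Sum.inr k))), hk, ?_⟩
        rw [redClassR_f]
        refine ⟨?_, x, Or.inr rfl, y, Or.inl hy', hxy⟩
        rwa [hb.mixedRealR_apply_F ⟨y, hy', x, ends_swap hxy⟩, if_pos hk] at hred
    · -- `x ∈ U j`, red
      have hσ : σ e = true := by
        rwa [hb.mixedRealR_apply_U ⟨x, hx, y, hxy⟩, if_pos hj] at hred
      refine ⟨Sum.inl j, hj, ?_⟩
      rw [redClassR_inl]
      refine ⟨hσ, x, Or.inl hx, y, ?_, hxy⟩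
      rw [mem_redSetR_iff] at hy
      rcases hy with rfl | ⟨j', _, hy⟩ | ⟨rfl, _⟩ | ⟨r, rfl, _⟩ | ⟨i, _, hy⟩ | ⟨k, _, hy⟩
      · exact Or.inr (Or.inl rfl)
      · by_cases hjj : j = j'
        · subst hjj
          exact Or.inl hy
        · exact absurd hy (fun hy => hb.no_cross_UU j j' hjj e x y hxy hx hy)
      · exact Or.inr (Or.inr rfl)
      · exact absurd hx (hb.no_pU (ends_swap hxy) j)
      · exact absurd hy (fun hy => hb.no_cross_UAh j i e x y hxy hx hy)
      · exact absurd hy (fun hy => hb.no_cross_UF j k e x y hxy hx hy)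
    · -- `x = u`: the edge goes into a u-arm or to a dropped vertex
      rcases hb.u_edges e y hxy with ⟨j, hy'⟩ | ⟨r, rfl⟩
      · have hj : q.1 j = true := (hb.mem_redSetR_U hy').1 hy
        refine ⟨Sum.inl j, hj, ?_⟩
        rw [redClassR_inl]
        refine ⟨?_, x, Or.inr (Or.inr rfl), y, Or.inl hy', hxy⟩
        rwa [hb.mixedRealR_apply_U ⟨y, hy', x, ends_swap hxy⟩, if_pos hj] at hred
      · have huP : q.2.2.1 r = true := (hb.mem_redSetR_p.1 hy).2
        refine ⟨Sum.inr (Sum.inr (Sum.inr (Sum.inl r))), ⟨hs, huP⟩, ?_⟩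
        rw [redClassR_p]
        exact hxy
    · -- `x = p r`: the edge goes to `u`, into a piece (dead) or outside
      by_cases hyu : y = u
      · subst hyu
        refine ⟨Sum.inr (Sum.inr (Sum.inr (Sum.inl r))), ⟨hs, huP⟩, ?_⟩
        rw [redClassR_p]
        exact ends_swap hxy
      rcases hb.p_edges r e y hxy with hyu' | ⟨i, hir, hy'⟩ | ⟨hyh, hyp, hyA⟩
      · exact absurd hyu' hyu
      · -- a dead edge, blue at the base: red only if the piece is flipped, a leak
        exfalso
        by_cases hi : q.2.1 i = true
        · rw [hb.mixedRealR_apply_Ah ⟨y, hy', p r, ends_swap hxy⟩, if_pos hi,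
            hb.dead_blue r e y hxy ⟨i, hy'⟩] at hred
          exact absurd hred (by decide)
        · exact hq ⟨hs, r, huP, Or.inr ⟨i, hir, by simpa using hi⟩⟩
      · exact absurd hy (not_mem_redSetR_of_out hyh hyu hyp hyA)
    · -- `x ∈ Ah i`, red
      have hσ : σ e = true := by
        rwa [hb.mixedRealR_apply_Ah ⟨x, hx, y, hxy⟩, if_pos hi] at hred
      refine ⟨Sum.inr (Sum.inr (Sum.inl i)), hi, ?_⟩
      rw [redClassR_a]
      refine ⟨hσ, x, Or.inl hx, y, ?_, hxy⟩
      rw [mem_redSetR_iff] at hy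
      rcases hy with rfl | ⟨j, _, hy⟩ | ⟨rfl, _⟩ | ⟨r, rfl, _⟩ | ⟨i', _, hy⟩ | ⟨k, _, hy⟩
      · exact Or.inr rfl
      · exact absurd hx (fun hx => hb.no_cross_UAh j i e y x (ends_swap hxy) hy hx)
      · exact absurd hx (hb.no_uAh (ends_swap hxy) i)
      · exfalso
        rw [hb.dead_blue r e x (ends_swap hxy) ⟨i, hx⟩] at hσ
        exact absurd hσ (by decide)
      · by_cases hii : i = i'
        · subst hii
          exact Or.inl hy
        · exact absurd hy (fun hy => hb.no_cross_AhAh i i' hii e x y hxy hx hy)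
      · exact absurd hy (fun hy => hb.no_cross_AhF i k e x y hxy hx hy)
    · -- `x ∈ F k`, red
      have hσ : σ e = true := by
        rwa [hb.mixedRealR_apply_F ⟨x, hx, y, hxy⟩, if_pos hk] at hred
      refine ⟨Sum.inr (Sum.inr (Sum.inr (Sum.inr k))), hk, ?_⟩
      rw [redClassR_f]
      refine ⟨hσ, x, Or.inl hx, y, ?_, hxy⟩
      rw [mem_redSetR_iff] at hy
      rcases hy with rfl | ⟨j, _, hy⟩ | ⟨rfl, _⟩ | ⟨r, rfl, _⟩ | ⟨i, _, hy⟩ | ⟨k', _, hy⟩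
      · exact Or.inr rfl
      · exact absurd hx (fun hx => hb.no_cross_UF j k e y x (ends_swap hxy) hy hx)
      · exact absurd hx (hb.no_uF (ends_swap hxy) k)
      · exact absurd hx (hb.no_pF (ends_swap hxy) k)
      · exact absurd hx (fun hx => hb.no_cross_AhF i k e y x (ends_swap hxy) hy hx)
      · by_cases hkk : k = k'
        · subst hkk
          exact Or.inl hy
        · exact absurd hy (fun hy => hb.no_cross_FF k k' hkk e x y hxy hx hy)
  · rintro ⟨α, hα, he⟩
    rcases α with j | ⟨⟨⟩⟩ | i | r | k
    · -- a red u-arm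
      have hj' : q.1 j = true := hα
      rw [redClassR_inl] at he
      obtain ⟨hσ, hw⟩ := he
      refine ⟨?_, ?_⟩
      · rw [hb.mixedRealR_apply_U (hb.touches_U_of_within' hw), if_pos hj']
        exact hσ
      · obtain ⟨x, hx, y, hy, hxy⟩ := hw
        exact ⟨x, hb.mem_redSetR_of_mem_U_h_u hj' hx, y, hb.mem_redSetR_of_mem_U_h_u hj' hy, hxy⟩
    · -- `u`: no edges of its own
      rw [redClassR_u] at he
      exact ((Set.mem_empty_iff_false e).1 he).elim
    · -- a red piece
      have hi' : q.2.1 i = true := hα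
      rw [redClassR_a] at he
      obtain ⟨hσ, hw⟩ := he
      refine ⟨?_, ?_⟩
      · rw [hb.mixedRealR_apply_Ah (hb.touches_Ah_of_within hw), if_pos hi']
        exact hσ
      · obtain ⟨x, hx, y, hy, hxy⟩ := hw
        exact ⟨x, hb.mem_redSetR_of_mem_Ah_h hi' hx, y, hb.mem_redSetR_of_mem_Ah_h hi' hy, hxy⟩
    · -- the u–p edges of an attached dropped vertex, red
      have hα' : (∃ j, q.1 j = true) ∧ q.2.2.1 r = true := hα
      rw [redClassR_p] at he
      have hup' : ends e = s(u, p r) := he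
      refine ⟨?_, u, hb.mem_redSetR_u.2 hα'.1, p r, hb.mem_redSetR_p.2 hα', hup'⟩
      rw [hb.mixedRealR_apply_UP he, if_pos hα'.2]
      exact hb.u_red e (p r) hup'
    · -- a red far arm
      have hk' : q.2.2.2.2 k = true := hα
      rw [redClassR_f] at he
      obtain ⟨hσ, hw⟩ := he
      refine ⟨?_, ?_⟩
      · rw [hb.mixedRealR_apply_F (hb.touches_F_of_within hw), if_pos hk']
        exact hσ
      · obtain ⟨x, hx, y, hy, hxy⟩ := hw
        exact ⟨x, hb.mem_redSetR_of_mem_F_h hk' hx, y, hb.mem_redSetR_of_mem_F_h hk' hy, hxy⟩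

end RedEdges

section BlueEdges

variable {ends : E → Sym2 V} {σ : Config E} {h u : V} {ι ρ ν κ : Type*} {U : ι → Set V}
  {p : ρ → V} {Ah : ν → Set V} {arm : ν → ρ} {F : κ → Set V}
  (hb : MixedBaseR ends σ h u U p Ah arm F)
include hb

/-- The dual base has the same red classes (their edges are class edges, where the dual base agrees
with the base). -/
lemma MixedBaseR.redClassR_dualMixedR (α : AtomR ι ρ ν κ) :
    redClassR ends (dualMixedR ends u U p Ah F σ) h u U p Ah F α =
      redClassR ends σ h u U p Ah F α := by
  rcases α with j | ⟨⟨⟩⟩ | i | r | k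
  · ext e
    simp only [redClassR_inl, Set.mem_setOf_eq]
    constructor
    · rintro ⟨hσ, hw⟩
      refine ⟨?_, hw⟩
      rwa [dualMixedR_apply_of_mem
        (Or.inl (Or.inl (Or.inl (Or.inl ⟨j, hb.touches_U_of_within' hw⟩))))] at hσ
    · rintro ⟨hσ, hw⟩
      refine ⟨?_, hw⟩
      rwa [dualMixedR_apply_of_mem
        (Or.inl (Or.inl (Or.inl (Or.inl ⟨j, hb.touches_U_of_within' hw⟩))))]
  · rfl
  · ext e
    simp only [redClassR_a, Set.mem_setOf_eq]
    constructor
    · rintro ⟨hσ, hw⟩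
      refine ⟨?_, hw⟩
      rwa [dualMixedR_apply_of_mem
        (Or.inl (Or.inl (Or.inl (Or.inr ⟨i, hb.touches_Ah_of_within hw⟩))))] at hσ
    · rintro ⟨hσ, hw⟩
      refine ⟨?_, hw⟩
      rwa [dualMixedR_apply_of_mem
        (Or.inl (Or.inl (Or.inl (Or.inr ⟨i, hb.touches_Ah_of_within hw⟩))))]
  · rfl
  · ext e
    simp only [redClassR_f, Set.mem_setOf_eq]
    constructor
    · rintro ⟨hσ, hw⟩
      refine ⟨?_, hw⟩
      rwa [dualMixedR_apply_of_mem (Or.inr ⟨k, hb.touches_F_of_within hw⟩)] at hσ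
    · rintro ⟨hσ, hw⟩
      refine ⟨?_, hw⟩
      rwa [dualMixedR_apply_of_mem (Or.inr ⟨k, hb.touches_F_of_within hw⟩)]

/-- The edge map of the dual base is the edge map of the base. -/
lemma MixedBaseR.φR_dualMixedR (S : Set (AtomR ι ρ ν κ)) :
    φR ends (dualMixedR ends u U p Ah F σ) h u U p Ah F S = φR ends σ h u U p Ah F S := by
  simp only [φR, hb.redClassR_dualMixedR]

/-- **The blue edge-set form of the hull formula**: at a point without blue-side leak, the blue
edges of the blue cluster of `h` are exactly the red classes of the abstract blue set (duality). -/
theorem MixedBaseR.blueEdges_mixedRealR (hup : ∀ r, ∃ e, ends e = s(u, p r)) {q : PtR ι ρ ν κ}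
    (hq : ¬ LeakBR arm q) :
    blueEdges ends (mixedRealR ends u U p Ah F σ q) h = φR ends σ h u U p Ah F (EB q) := by
  rw [blueEdges, hb.blue_mixedRealR, hb.dual.redEdges_mixedRealR hup hq, hb.φR_dualMixedR]
  rfl

end BlueEdges

end MixedArms

end Summit.Ventures.PercRepro2
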